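import Summits.AtomisticToContinuum.HydrodynamicLimit.Theorems.InformationPercolationEnginePercolationClosesChaosForecastAlgebraMeans
import Summits.AtomisticToContinuum.HydrodynamicLimit.Theorems.InformationPercolationEnginePercolationClosesChaosCesaroTransfer
import HarnessLib

/-!
# Forecast transfer S6 of the line `equilibrium-forecast-chain-rule` (crux `InformationPercolationEngine.PercolationClosesChaos`,
stmt-AtomisticToContinuum-15178) — piece H5b: `ForecastAlgebra` HOLDS (parts (ii), (iii) and the assembly)

Support file (`--supports stmt-AtomisticToContinuum-15178`) of the registered stub `stub_forecastTransfer` (worker W2 of lead c3,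
skeleton v5): the fifth hypothesis `H5 = ForecastAlgebra` of the architecture `kineticCellChaosLG_of` (piece A,
`…ForecastTransferArch`) is DISCHARGED — registered headline `forecastAlgebra_holds : ForecastAlgebra`. With the toolbox of piece H5a
(`…ForecastAlgebraMeans`: integrability of `badWeight`, of revealed families and of forecasts under laws `≪ liouville` / `≪ G_N`,
unit means as integrals of finite box sums, parts (i) `unitMean_badWeight_le_of_revealed` and (iv) `lintegral_unitAvg_badWeight_eq`,
and the empty-cell pull-out `ae_gForecast_badWeight_eq_zero_of_empty`):

* part (ii) `unitMean_gForecast_le_of_sandwich` — for a finite law `μ ≪ G_N` and revealed, box-supported, `[0, T]`-valued `X, R` with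
  `X ≤ badWeight Ψ η' T + R` on the good set: `unitMean μ (Ĝ X) ≤ unitMean μ (Ĝ badWeight) + unitMean μ (Ĝ R)` (`condExp_mono`,
  `condExp_add` under `G_N`, `G_N(goodᶜ) = 0`, transported to `μ`-a.e. by `μ ≪ G_N`, summed over the box, integrated);
* part (iii) `unitMean_gForecast_badWeight_le_split` — for a probability law `μ ≪ G_N`:
  `unitMean μ (Ĝ bW) ≤ δ h³ #cellBox h + T · unitMean μ 𝟙{Good ∧ δ < Ĝ bW} + T · unitMean μ 𝟙{occupied ∧ ¬Good}`, from the
  `μ`-a.e. per-unit split `Ĝ bW ≤ δ 𝟙_box + T 𝟙{Good ∧ δ < Ĝ bW} + T 𝟙{occupied ∧ ¬Good}` (`0 ≤ Ĝ bW ≤ T` a.e., and `Ĝ bW = 0`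
  a.e. on empty cells by the pull-out) and `unitAvg (δ 𝟙_box) ≤ δ h³ #cellBox h`;
* `forecastAlgebra_holds` — `μ = LG = localGibbsLaw σ a₀ u₀ θ₀ N Φ` is a probability measure for `σ ≤ 1/2`, `≪ liouville`, and
  `≪ G_N` because `KL(LG ‖ G_N) ≤ A(N+1) < ∞` (`exists_lgTransferConst`, `InformationTheory.klDiv_ne_top_iff`).
-/

noncomputable section

open MeasureTheory Set Filter Topology
open scoped ENNReal BigOperators Classical
open Literature.Analysis.FluidPDE Literature.MathematicalPhysics.KineticTheory
open Literature.MathematicalPhysics.KineticTheory.VelocityBlindPlacement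

namespace Summit.AtomisticToContinuum.HydrodynamicLimit.Theorems.EquilibriumForecastLine

variable {σ : ℝ} {N : ℕ}

/-! ## Part (ii): a sandwich on the good set passes to the means of the forecasts -/

/-- **Part (ii) of `ForecastAlgebra`.** For a finite law `μ ≪ G_N`, `0 < σ < 1/2`, `Ψ` continuous, `0 ≤ T`, `0 < c`, and revealed,
box-supported, `[0, T]`-valued unit families `X, R` with `X ≤ badWeight Ψ η' T + R` unit by unit on the good set:
`unitMean μ (Ĝ X) ≤ unitMean μ (Ĝ badWeight) + unitMean μ (Ĝ R)` (`Ĝ = gForecast b c σ N Φ`; `condExp_mono`, `condExp_add` under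
`G_N`, `G_N(goodᶜ) = 0`, transported to `μ`-a.e. by `μ ≪ G_N`, summed over the box and integrated). [folklore] -/
theorem unitMean_gForecast_le_of_sandwich (Φ : Flow σ N) (μ : Measure (Phase N)) [IsFiniteMeasure μ] (hμ : μ ≪ eqLaw σ N Φ)
    (hσ : 0 < σ) (hσ2 : σ < 2⁻¹) {Ψ : V3 × V3 × V3 → ℝ} (hΨ : Continuous Ψ) (η' : ℝ) {T c : ℝ} (b τ : ℝ) (hT : 0 ≤ T)
    (hc : 0 < c) {X R : ℕ → Cell → Phase N → ℝ}
    (hXb : ∀ k q z, 0 ≤ X k q z ∧ X k q z ≤ T) (hRb : ∀ k q z, 0 ≤ R k q z ∧ R k q z ≤ T)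
    (hX0 : ∀ k, ∀ q ∉ cellBox (c * meanFreePath σ N), X k q = fun _ => 0)
    (hR0 : ∀ k, ∀ q ∉ cellBox (c * meanFreePath σ N), R k q = fun _ => 0)
    (hXa : ∀ k q, q ∈ cellBox (c * meanFreePath σ N) → ∀ z z',
      seqHistLE b c σ N Φ k q z = seqHistLE b c σ N Φ k q z' → X k q z = X k q z')
    (hRa : ∀ k q, q ∈ cellBox (c * meanFreePath σ N) → ∀ z z',
      seqHistLE b c σ N Φ k q z = seqHistLE b c σ N Φ k q z' → R k q z = R k q z')
    (hsand : ∀ k q, ∀ z ∈ Φ.good, X k q z ≤ badWeight Ψ η' T c σ N Φ k q z + R k q z) :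
    unitMean c σ N τ μ (gForecast b c σ N Φ X) ≤
      unitMean c σ N τ μ (gForecast b c σ N Φ (badWeight Ψ η' T c σ N Φ)) +
        unitMean c σ N τ μ (gForecast b c σ N Φ R) := by
  set G := eqLaw σ N Φ with hG
  have hh : 0 < c * meanFreePath σ N := mul_pos hc (meanFreePath_pos hσ N)
  haveI : IsProbabilityMeasure G := isProbabilityMeasure_eqLaw (hσ2.le.trans (by norm_num)) N Φ
  have hGac : G ≪ liouville G3 (N + 1) (hsDiameter σ N) := eqLaw_absolutelyContinuous σ N Φ
  -- bounds and integrability of the three families, unit by unit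
  have hXabs : ∀ k q z, |X k q z| ≤ T := fun k q z => abs_le_of_unitBounds (hXb k q z)
  have hRabs : ∀ k q z, |R k q z| ≤ T := fun k q z => abs_le_of_unitBounds (hRb k q z)
  have hBabs : ∀ k q z, |badWeight Ψ η' T c σ N Φ k q z| ≤ T := fun k q z => abs_badWeight_le_level hc.le hσ Ψ η' hT Φ k q z
  have hXiG : ∀ k q, Integrable (X k q) G := fun k q =>
    integrable_of_measurable_abs_le G (measurable_unitFamily Φ b c hX0 hXa k q) (hXabs k q)
  have hRiG : ∀ k q, Integrable (R k q) G := fun k q =>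
    integrable_of_measurable_abs_le G (measurable_unitFamily Φ b c hR0 hRa k q) (hRabs k q)
  have hBiG : ∀ k q, Integrable (badWeight Ψ η' T c σ N Φ k q) G := fun k q =>
    integrable_badWeight_of_ac Φ G hGac hσ hσ2 hΨ η' hT hc k q
  -- per unit, `G_N`-a.e.: `Ĝ X ≤ Ĝ badWeight + Ĝ R`
  have hunit : ∀ k q, ∀ᵐ z ∂G, gForecast b c σ N Φ X k q z ≤
      gForecast b c σ N Φ (badWeight Ψ η' T c σ N Φ) k q z + gForecast b c σ N Φ R k q z := by
    intro k q
    have hle : X k q ≤ᵐ[G] (badWeight Ψ η' T c σ N Φ k q + R k q) := by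
      filter_upwards [ae_mem_good_of_ac Φ hGac] with z hz
      exact hsand k q z hz
    have h1 := condExp_mono (m := MeasurableSpace.comap (seqHist b c σ N Φ k q) ⊤) (hXiG k q) ((hBiG k q).add (hRiG k q)) hle
    have h2 := condExp_add (hBiG k q) (hRiG k q) (MeasurableSpace.comap (seqHist b c σ N Φ k q) ⊤)
    filter_upwards [h1, h2] with z hz1 hz2
    exact hz1.trans_eq hz2
  have hall : ∀ᵐ z ∂μ, ∀ k q, gForecast b c σ N Φ X k q z ≤
      gForecast b c σ N Φ (badWeight Ψ η' T c σ N Φ) k q z + gForecast b c σ N Φ R k q z :=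
    ae_all_iff.2 fun k => ae_all_iff.2 fun q => hμ.ae_le (hunit k q)
  -- box support of the forecasts
  have hGX0 : ∀ (z : Phase N) (k : ℕ), ∀ q ∉ cellBox (c * meanFreePath σ N), gForecast b c σ N Φ X k q z = 0 :=
    fun z k q hq => gForecast_apply_eq_zero_of_forall Φ b c (fun z => by rw [hX0 k q hq]) z
  have hGR0 : ∀ (z : Phase N) (k : ℕ), ∀ q ∉ cellBox (c * meanFreePath σ N), gForecast b c σ N Φ R k q z = 0 :=
    fun z k q hq => gForecast_apply_eq_zero_of_forall Φ b c (fun z => by rw [hR0 k q hq]) z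
  have hGB0 : ∀ (z : Phase N) (k : ℕ), ∀ q ∉ cellBox (c * meanFreePath σ N),
      gForecast b c σ N Φ (badWeight Ψ η' T c σ N Φ) k q z = 0 :=
    fun z k q hq => gForecast_apply_eq_zero_of_forall Φ b c (fun z => badWeight_eq_zero_of_not_mem hh Ψ η' hT Φ k hq z) z
  have hGBR0 : ∀ (z : Phase N) (k : ℕ), ∀ q ∉ cellBox (c * meanFreePath σ N),
      gForecast b c σ N Φ (badWeight Ψ η' T c σ N Φ) k q z + gForecast b c σ N Φ R k q z = 0 := fun z k q hq => by
    rw [hGB0 z k q hq, hGR0 z k q hq, add_zero]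
  -- integrability of the unit averages under `μ`
  have hiX : Integrable (fun z => unitAvg c σ N τ fun k q => gForecast b c σ N Φ X k q z) μ :=
    integrable_unitAvg_family τ hGX0 fun k q => integrable_gForecast Φ b c hμ k q (hXabs k q)
  have hiR : Integrable (fun z => unitAvg c σ N τ fun k q => gForecast b c σ N Φ R k q z) μ :=
    integrable_unitAvg_family τ hGR0 fun k q => integrable_gForecast Φ b c hμ k q (hRabs k q)
  have hiB : Integrable (fun z => unitAvg c σ N τ fun k q => gForecast b c σ N Φ (badWeight Ψ η' T c σ N Φ) k q z) μ :=
    integrable_unitAvg_family τ hGB0 fun k q => integrable_gForecast Φ b c hμ k q (hBabs k q)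
  have hiBR : Integrable (fun z => unitAvg c σ N τ fun k q =>
      gForecast b c σ N Φ (badWeight Ψ η' T c σ N Φ) k q z + gForecast b c σ N Φ R k q z) μ :=
    integrable_unitAvg_family τ hGBR0 fun k q =>
      (integrable_gForecast Φ b c hμ k q (hBabs k q)).add (integrable_gForecast Φ b c hμ k q (hRabs k q))
  calc unitMean c σ N τ μ (gForecast b c σ N Φ X)
      ≤ unitMean c σ N τ μ (fun k q z =>
          gForecast b c σ N Φ (badWeight Ψ η' T c σ N Φ) k q z + gForecast b c σ N Φ R k q z) :=
        unitMean_mono_ae τ hh.le hGX0 hGBR0 hiX hiBR hall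
    _ = unitMean c σ N τ μ (gForecast b c σ N Φ (badWeight Ψ η' T c σ N Φ)) +
          unitMean c σ N τ μ (gForecast b c σ N Φ R) := unitMean_add_family τ hGB0 hGR0 hiB hiR

/-! ## Part (iii): the per-unit split -/

/-- **Part (iii) of `ForecastAlgebra`: the per-unit split of the mean forecast.** For a probability law `μ ≪ G_N`, `0 < σ < 1/2`,
`Ψ` continuous, `0 < T`, `0 < c`, `0 < δ` and any `ϑs, ϑ, φs`:
`unitMean μ (Ĝ bW) ≤ δ · h³ · #cellBox h + T · unitMean μ 𝟙{Good ∧ δ < Ĝ bW} + T · unitMean μ 𝟙{occupied ∧ ¬Good}`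
(`bW = badWeight Ψ η' T`, `Ĝ = gForecast b c σ N Φ`). Pointwise `μ`-a.e. per unit of the box
`Ĝ bW ≤ δ + T 𝟙{Good ∧ δ < Ĝ bW} + T 𝟙{occupied ∧ ¬Good}`, because `0 ≤ Ĝ bW ≤ T` a.e. and `Ĝ bW = 0` a.e. on empty cells
(`ae_gForecast_badWeight_eq_zero_of_empty`); then `unitAvg (δ 𝟙_box) ≤ δ h³ #cellBox h`. [folklore] -/
theorem unitMean_gForecast_badWeight_le_split (Φ : Flow σ N) (μ : Measure (Phase N)) [IsProbabilityMeasure μ]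
    (hμ : μ ≪ eqLaw σ N Φ) (hσ : 0 < σ) (hσ2 : σ < 2⁻¹) {Ψ : V3 × V3 × V3 → ℝ} (hΨ : Continuous Ψ) (η' : ℝ) {T c δ : ℝ}
    (b τ ϑs ϑ φs : ℝ) (hT : 0 < T) (hc : 0 < c) (hδ : 0 < δ) :
    unitMean c σ N τ μ (gForecast b c σ N Φ (badWeight Ψ η' T c σ N Φ)) ≤
      δ * ((c * meanFreePath σ N) ^ 3 * (cellBox (c * meanFreePath σ N)).card) +
      T * unitMean c σ N τ μ (fun k q z =>
        if GoodUnit ϑs ϑ φs c σ N (Φ.flow ((k : ℝ) * stepLen c σ N) z) q ∧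
            δ < gForecast b c σ N Φ (badWeight Ψ η' T c σ N Φ) k q z
        then 1 else 0) +
      T * unitMean c σ N τ μ (fun k q z =>
        if (pop c σ N (Φ.flow ((k : ℝ) * stepLen c σ N) z) q).Nonempty ∧
            ¬ GoodUnit ϑs ϑ φs c σ N (Φ.flow ((k : ℝ) * stepLen c σ N) z) q
        then 1 else 0) := by
  set G := eqLaw σ N Φ with hG
  set V : ℕ → Cell → Phase N → ℝ := gForecast b c σ N Φ (badWeight Ψ η' T c σ N Φ) with hV
  set I₁ : ℕ → Cell → Phase N → ℝ := fun k q z =>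
    if GoodUnit ϑs ϑ φs c σ N (Φ.flow ((k : ℝ) * stepLen c σ N) z) q ∧ δ < V k q z then 1 else 0 with hI₁
  set I₂ : ℕ → Cell → Phase N → ℝ := fun k q z =>
    if (pop c σ N (Φ.flow ((k : ℝ) * stepLen c σ N) z) q).Nonempty ∧
      ¬ GoodUnit ϑs ϑ φs c σ N (Φ.flow ((k : ℝ) * stepLen c σ N) z) q then 1 else 0 with hI₂
  have hh : 0 < c * meanFreePath σ N := mul_pos hc (meanFreePath_pos hσ N)
  -- box support
  have hB0 : ∀ (z : Phase N) (k : ℕ), ∀ q ∉ cellBox (c * meanFreePath σ N), badWeight Ψ η' T c σ N Φ k q z = 0 :=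
    fun z k q hq => badWeight_eq_zero_of_not_mem hh Ψ η' hT.le Φ k hq z
  have hV0 : ∀ (z : Phase N) (k : ℕ), ∀ q ∉ cellBox (c * meanFreePath σ N), V k q z = 0 :=
    fun z k q hq => gForecast_apply_eq_zero_of_forall Φ b c (fun z => hB0 z k q hq) z
  have hI₁0 : ∀ (z : Phase N) (k : ℕ), ∀ q ∉ cellBox (c * meanFreePath σ N), I₁ k q z = 0 := by
    intro z k q hq
    simp only [hI₁]
    rw [if_neg]
    rintro ⟨-, hlt⟩
    rw [hV0 z k q hq] at hlt
    exact lt_irrefl _ (hδ.trans hlt)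
  have hI₂0 : ∀ (z : Phase N) (k : ℕ), ∀ q ∉ cellBox (c * meanFreePath σ N), I₂ k q z = 0 :=
    fun z k q hq => indicator_pop_eq_zero_of_not_mem hh Φ
      (fun k q z => ¬ GoodUnit ϑs ϑ φs c σ N (Φ.flow ((k : ℝ) * stepLen c σ N) z) q) z k hq
  -- per-unit a.e. facts under `G_N`, transported to `μ`
  have hBabs : ∀ k q z, |badWeight Ψ η' T c σ N Φ k q z| ≤ T := fun k q z => abs_badWeight_le_level hc.le hσ Ψ η' hT.le Φ k q z
  have hVnn : ∀ k q, ∀ᵐ z ∂G, 0 ≤ V k q z := fun k q =>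
    ae_gForecast_nonneg Φ b c fun z => badWeight_nonneg hc.le hσ Ψ η' hT.le Φ k q z
  have hVle : ∀ k q, ∀ᵐ z ∂G, V k q z ≤ T := fun k q =>
    (ae_abs_gForecast_le Φ b c k q (hBabs k q)).mono fun z hz => (le_abs_self _).trans hz
  have hVemp : ∀ (k : ℕ) (q : Cell), ∀ᵐ z ∂G, ¬ (pop c σ N (Φ.flow ((k : ℝ) * stepLen c σ N) z) q).Nonempty →
      V k q z = 0 :=
    fun k q => ae_gForecast_badWeight_eq_zero_of_empty Φ hσ hσ2 hΨ η' b hT.le hc k q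
  have hall : ∀ᵐ z ∂μ, ∀ k q, (0 ≤ V k q z ∧ V k q z ≤ T) ∧
      (¬ (pop c σ N (Φ.flow ((k : ℝ) * stepLen c σ N) z) q).Nonempty → V k q z = 0) :=
    ae_all_iff.2 fun k => ae_all_iff.2 fun q => hμ.ae_le (((hVnn k q).and (hVle k q)).and (hVemp k q))
  -- the pointwise split
  have hpt : ∀ᵐ z ∂μ, ∀ k q, V k q z ≤
      (if q ∈ cellBox (c * meanFreePath σ N) then δ else 0) + T * I₁ k q z + T * I₂ k q z := by
    filter_upwards [hall] with z hz k q
    obtain ⟨⟨h0, hT'⟩, hemp⟩ := hz k q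
    have i1 : 0 ≤ I₁ k q z := by simp only [hI₁]; positivity
    have i2 : 0 ≤ I₂ k q z := by simp only [hI₂]; positivity
    by_cases hq : q ∈ cellBox (c * meanFreePath σ N)
    · rw [if_pos hq]
      by_cases hle : V k q z ≤ δ
      · nlinarith
      · have hlt : δ < V k q z := not_le.1 hle
        have hne : (pop c σ N (Φ.flow ((k : ℝ) * stepLen c σ N) z) q).Nonempty := by
          by_contra hne
          have := hemp hne
          linarith
        by_cases hgood : GoodUnit ϑs ϑ φs c σ N (Φ.flow ((k : ℝ) * stepLen c σ N) z) q
        · have e1 : I₁ k q z = 1 := by simp only [hI₁]; exact if_pos ⟨hgood, hlt⟩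
          nlinarith
        · have e2 : I₂ k q z = 1 := by simp only [hI₂]; exact if_pos ⟨hne, hgood⟩
          nlinarith
    · rw [if_neg hq, hV0 z k q hq, hI₁0 z k q hq, hI₂0 z k q hq]
      simp
  -- integrability
  have hVi : Integrable (fun z => unitAvg c σ N τ fun k q => V k q z) μ :=
    integrable_unitAvg_family τ hV0 fun k q => integrable_gForecast Φ b c hμ k q (hBabs k q)
  have hI₁m : ∀ (k : ℕ) (q : Cell), MeasurableSet {z : Phase N |
      GoodUnit ϑs ϑ φs c σ N (Φ.flow ((k : ℝ) * stepLen c σ N) z) q ∧ δ < V k q z} := fun k q =>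
    ((measurableSet_goodUnit ϑs ϑ φs c σ q).preimage (Φ.measurable_flow _)).inter
      (measurableSet_lt measurable_const (measurable_gForecast Φ b c _ k q))
  have hI₂m : ∀ (k : ℕ) (q : Cell), MeasurableSet {z : Phase N |
      (pop c σ N (Φ.flow ((k : ℝ) * stepLen c σ N) z) q).Nonempty ∧
      ¬ GoodUnit ϑs ϑ φs c σ N (Φ.flow ((k : ℝ) * stepLen c σ N) z) q} := fun k q =>
    ((measurableSet_pop_nonempty c σ q).preimage (Φ.measurable_flow _)).inter
      ((measurableSet_goodUnit ϑs ϑ φs c σ q).preimage (Φ.measurable_flow _)).compl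
  have hI₁i : Integrable (fun z => unitAvg c σ N τ fun k q => I₁ k q z) μ :=
    integrable_unitAvg_family τ hI₁0 fun k q => integrable_unitIndicator μ (hI₁m k q)
  have hI₂i : Integrable (fun z => unitAvg c σ N τ fun k q => I₂ k q z) μ :=
    integrable_unitAvg_family τ hI₂0 fun k q => integrable_unitIndicator μ (hI₂m k q)
  -- the bounding family and its unit average
  have e1 : ∀ (k : ℕ), ∀ q ∉ cellBox (c * meanFreePath σ N), (if q ∈ cellBox (c * meanFreePath σ N) then δ else (0 : ℝ)) = 0 :=
    fun k q hq => if_neg hq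
  have hBeq : ∀ z, unitAvg c σ N τ (fun k q =>
      (if q ∈ cellBox (c * meanFreePath σ N) then δ else 0) + T * I₁ k q z + T * I₂ k q z) =
      unitAvg c σ N τ (fun _ q => if q ∈ cellBox (c * meanFreePath σ N) then δ else 0) +
        T * unitAvg c σ N τ (fun k q => I₁ k q z) + T * unitAvg c σ N τ (fun k q => I₂ k q z) := by
    intro z
    have e2 : ∀ (k : ℕ), ∀ q ∉ cellBox (c * meanFreePath σ N), T * I₁ k q z = 0 := fun k q hq => by
      rw [hI₁0 z k q hq, mul_zero]
    have e3 : ∀ (k : ℕ), ∀ q ∉ cellBox (c * meanFreePath σ N), T * I₂ k q z = 0 := fun k q hq => by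
      rw [hI₂0 z k q hq, mul_zero]
    have e12 : ∀ (k : ℕ), ∀ q ∉ cellBox (c * meanFreePath σ N),
        (if q ∈ cellBox (c * meanFreePath σ N) then δ else (0 : ℝ)) + T * I₁ k q z = 0 := fun k q hq => by
      rw [e1 k q hq, e2 k q hq, add_zero]
    rw [unitAvg_add' τ (F := fun k q => (if q ∈ cellBox (c * meanFreePath σ N) then δ else (0 : ℝ)) + T * I₁ k q z)
      (G := fun k q => T * I₂ k q z) e12 e3,
      unitAvg_add' τ (F := fun _ q => if q ∈ cellBox (c * meanFreePath σ N) then δ else (0 : ℝ))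
      (G := fun k q => T * I₁ k q z) e1 e2, unitAvg_const_mul', unitAvg_const_mul']
  have hB0' : ∀ (z : Phase N) (k : ℕ), ∀ q ∉ cellBox (c * meanFreePath σ N),
      (if q ∈ cellBox (c * meanFreePath σ N) then δ else 0) + T * I₁ k q z + T * I₂ k q z = 0 := fun z k q hq => by
    rw [e1 k q hq, hI₁0 z k q hq, hI₂0 z k q hq, mul_zero, add_zero, add_zero]
  have hδbox := unitAvg_boxConst_le τ hδ.le hh.le (σ := σ) (N := N)
  have hbound : ∀ᵐ z ∂μ, (unitAvg c σ N τ fun k q => V k q z) ≤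
      δ * ((c * meanFreePath σ N) ^ 3 * (cellBox (c * meanFreePath σ N)).card) +
        T * unitAvg c σ N τ (fun k q => I₁ k q z) + T * unitAvg c σ N τ (fun k q => I₂ k q z) := by
    filter_upwards [hpt] with z hz
    calc (unitAvg c σ N τ fun k q => V k q z)
        ≤ unitAvg c σ N τ (fun k q => (if q ∈ cellBox (c * meanFreePath σ N) then δ else 0) + T * I₁ k q z + T * I₂ k q z) :=
          unitAvg_mono hh.le (hV0 z) (hB0' z) hz
      _ = _ := hBeq z
      _ ≤ _ := by linarith
  have hRi1 : Integrable (fun z => δ * ((c * meanFreePath σ N) ^ 3 * (cellBox (c * meanFreePath σ N)).card) +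
      T * unitAvg c σ N τ (fun k q => I₁ k q z)) μ :=
    (integrable_const _).add (hI₁i.const_mul T)
  have hRi : Integrable (fun z => δ * ((c * meanFreePath σ N) ^ 3 * (cellBox (c * meanFreePath σ N)).card) +
      T * unitAvg c σ N τ (fun k q => I₁ k q z) + T * unitAvg c σ N τ (fun k q => I₂ k q z)) μ :=
    hRi1.add (hI₂i.const_mul T)
  calc unitMean c σ N τ μ V = ∫ z, unitAvg c σ N τ (fun k q => V k q z) ∂μ := rfl
    _ ≤ ∫ z, δ * ((c * meanFreePath σ N) ^ 3 * (cellBox (c * meanFreePath σ N)).card) +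
          T * unitAvg c σ N τ (fun k q => I₁ k q z) + T * unitAvg c σ N τ (fun k q => I₂ k q z) ∂μ :=
        integral_mono_ae hVi hRi hbound
    _ = δ * ((c * meanFreePath σ N) ^ 3 * (cellBox (c * meanFreePath σ N)).card) +
          T * unitMean c σ N τ μ I₁ + T * unitMean c σ N τ μ I₂ := by
        rw [integral_add hRi1 (hI₂i.const_mul T), integral_add (integrable_const _) (hI₁i.const_mul T),
          integral_const_mul T, integral_const_mul T, integral_const, smul_eq_mul, probReal_univ, one_mul]
        rfl

/-! ## H5 assembled -/

/-- **Registered stub H5 `forecastAlgebra_holds` (worker W2 of S6): `ForecastAlgebra` holds.** With `LG = localGibbsLaw σ a₀ u₀ θ₀ N Φ`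
(a probability measure for `σ ≤ 1/2`, `≪ liouville`, and `≪ G_N = eqLaw σ N Φ` because `KL(LG ‖ G_N) ≤ A(N+1) < ∞`,
`exists_lgTransferConst`): (i) is `unitMean_badWeight_le_of_revealed`, (ii) is `unitMean_gForecast_le_of_sandwich`, (iii) is
`unitMean_gForecast_badWeight_le_split`, (iv) is `lintegral_unitAvg_badWeight_eq`. [folklore] -/
theorem forecastAlgebra_holds : ForecastAlgebra := by
  intro a₀ θ₀ u₀ ha hθ hu ha0 hθ0 σ hσ hhalf N Φ τ _ Ψ hΨ _ η T c b _ hT hc _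
  have hσ2 : σ < 2⁻¹ := hhalf.trans_eq (one_div (2 : ℝ))
  set μ := localGibbsLaw σ a₀ u₀ θ₀ N Φ with hμdef
  haveI : IsProbabilityMeasure μ := isProbabilityMeasure_localGibbsLaw ha hθ hu ha0 hθ0 hhalf.le N Φ
  haveI : IsProbabilityMeasure (eqLaw σ N Φ) := isProbabilityMeasure_eqLaw hhalf.le N Φ
  have hμL : μ ≪ liouville G3 (N + 1) (hsDiameter σ N) := localGibbsLaw_absolutelyContinuous_liouville σ a₀ u₀ θ₀ N Φ
  obtain ⟨A, -, hLG⟩ := exists_lgTransferConst ha hθ hu ha0 hθ0 hhalf.le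
  obtain ⟨hkl, -, -, -, -⟩ := hLG N Φ
  have hkl_ne : InformationTheory.klDiv μ (eqLaw σ N Φ) ≠ ∞ := ne_top_of_le_ne_top ENNReal.ofReal_ne_top hkl
  have hμG : μ ≪ eqLaw σ N Φ := (InformationTheory.klDiv_ne_top_iff.1 hkl_ne).1
  refine ⟨?_, ?_, ?_, ?_⟩
  · intro X hXb hX0 hXa hdom
    exact unitMean_badWeight_le_of_revealed Φ μ hμL hσ Ψ η b τ hT.le hc hXb hX0 hXa hdom
  · intro η' _ X R hXb hRb hX0 hR0 hXa hRa hsand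
    exact unitMean_gForecast_le_of_sandwich Φ μ hμG hσ hσ2 hΨ η' b τ hT.le hc hXb hRb hX0 hR0 hXa hRa hsand
  · intro η' δ ϑs ϑ φs _ hδ
    exact unitMean_gForecast_badWeight_le_split Φ μ hμG hσ hσ2 hΨ η' b τ ϑs ϑ φs hT hc hδ
  · exact lintegral_unitAvg_badWeight_eq Φ μ hμL hσ hσ2 hΨ η τ hT.le hc

end Summit.AtomisticToContinuum.HydrodynamicLimit.Theorems.EquilibriumForecastLine

end
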